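import Summits.QuantumFields.YangMills.Theorems.BalabanUVNodesC44IterMhProp4Node00
import HarnessLib

/-!
# (ℓa-C) ROAD B, FILE F8 — THE PLAQUETTE BRIDGE: lit's carrier `plaqHolU (unitsOfRecord U₀)` IS the tree's `GaugeField.plaqHol U₀` (matrix reading), so the `j = 0` clause
# `hpl` of F7 ✓`prop4UniformAtRecord_node00_of_HCol(_window)` is the tree's `PlaqSmall (αη_k²) U₀` — and for `0 < k` it is ALREADY the `j = 0` member of `hreg`

Cell `pub-ymgap` ∕ `ym-nodeO-ideate`, porter lineage `ymgap-nodeO-port-PTB-1` (gen 8); ★★★ director-ym g22 №578 (2)(i) («NOW, S: the cosmetic bridge `hpl∕hreg (j = 0)` (lit-carrier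
`plaqHolU (unitsOfRecord …)` ↔ `Setup.PlaqSmall`) as one helper»).  `--kind proof --supports stmt-QuantumFields-27238 --as helper`; count-neutral.
[B11] = [Balaban1985Variational]; [B9] = [Balaban1985BackgroundPropagators]; [RG1] = [Balaban1987RG1].

WHY.  F7 displays print's regularity (14) TWICE: `hreg : ∀ j < k, PlaqSmall (α(L^jη_k)²) (Ū^j U₀)` on the tree's carrier (`Setup.PlaqSmall`, `GaugeField.plaqHol`, `Site = ZMod`-coordinates)
and `hpl : ∀ p, ‖plaqHolU (unitsOfRecord F N U₀) p − 1‖ ≤ αη_k²` on lit's carrier (`B9Eq310DeltaPrime.plaqHolU`, `TSite = Fin`-coordinates) — «the two plaquette conventions are not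
bridged in the tree, so both are displayed» (F7 docstring).  This file bridges them: the record's background read on lit's bonds (`unitsOfRecord`, def-Y's ✓`BgCarriersOfRecordLit`,
along the equivalences `siteToLit`∕`bondToLit` which intertwine the unit steps, ✓`siteToLit_shift`) has, plaquette by plaquette, the SAME holonomy matrix as the tree's `plaqHol U₀`
(both are `U_μ(x)·U_ν(x+e_μ)·U_μ(x+e_ν)⁻¹·U_ν(x)⁻¹`, [B7] (9) = [B9] (3.1)∕(3.5)); and in the tree's `SU(N)` model `dist1 g = ‖↑g − 1‖` definitionally.  Hence
`PlaqSmall δ U₀ ⇒ hpl` with the same `δ`, and since `Ū^0(U₀) = U₀` (`rfl`) and `L^0 = 1`, for `0 < k` the `j = 0` member of `hreg` IS `hpl`.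

WHAT THIS FILE PROVES (ns `…Theorems.C44IterMh`; 0 def):
§1 `coe_plaqHolU_unitsOfRecord` (lit plaquette of a tree plaquette), `coe_plaqHolU_unitsOfRecord'` (every lit plaquette), ★ `norm_plaqHolU_unitsOfRecord_sub_one_le_of_plaqSmall`,
   `plaqSmall_base_of_hreg` (`0 < k`: the `j = 0` member of the (14) tower is `PlaqSmall (αη_k²) U₀`).
§2 ★★ `prop4UniformAtRecord_node00_of_HCol_plaqSmall` ∕ `…_window_plaqSmall` — F7's two doors with `hpl` replaced by the tree-side `hpl0 : PlaqSmall (αη_k²) U₀`;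
   ★★ `prop4UniformAtRecord_node00_of_HCol_pos` ∕ `…_window_pos` — for `0 < k`, NO separate `j = 0` clause: the antecedent is (ℓa-H) + (ℓd) + `hreg` (+ `‖J‖ ≤ nJ` ∕ the (14) current
   window) and nothing else.

HONEST FRAMING.  Bookkeeping (carrier dictionary); no estimate.  (ℓa-C) discharged ONLY in the node-00 regime `Ω_j = T` (F6∕F7); (ℓa-H), (ℓd) DISPLAYED; (R1)∕(R2) OPEN; K0ᴬ
⟨stmt-QuantumFields-27238⟩ NOT closed; K0ᴬ∕K1ᴬ∕K3ᴬ 0∕3; NODE O 0∕1; COUNT 8∕28 · K 1∕4 UNMOVED; finite `𝕋⁴_{L^K}` at fixed ε — NOT continuum ∕ ℝ⁴ ∕ OS; **the Yang–Mills mass gap (Clay)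
is NOT proved by any of this.**  No `sorry`, `instance`, `notation`, `set_option`; standard axioms.
-/

noncomputable section

open scoped Matrix Matrix.Norms.L2Operator InnerProductSpace ComplexConjugate Topology NNReal

namespace Summit.QuantumFields.YangMills.Theorems.C44IterMh

open Literature.MathematicalPhysics.QuantumFieldTheory.Balaban1983to89
open Literature.MathematicalPhysics.QuantumFieldTheory.Balaban1983to89.Node00
open T4Continuum BlockAveraging
open B9Eq310DeltaPrime (plaqHolU)
open B11Eq103H1Complex (SiteL2K)
open B11Eq115Space (NegSup levWeight)

/-! ## §1  The plaquette dictionary `plaqHolU (unitsOfRecord U₀) ↔ GaugeField.plaqHol U₀` -/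

section Bridge

variable (F : T4Family) (N : ℕ) [NeZero N] {K : ℕ} (U₀ : GaugeField (F.P K) 0 (SU N))

/-- **LIT's PLAQUETTE HOLONOMY OF THE RECORD's BACKGROUND IS THE TREE's, AS A MATRIX** (tree plaquette `p`, read on lit's carrier at `(siteToLit p.src, (μ, ν))`): both are
`U_μ(x)·U_ν(x+e_μ)·U_μ(x+e_ν)⁻¹·U_ν(x)⁻¹`; the bridge `siteToLit` intertwines the unit steps (✓`siteToLit_shift`). [cite: Balaban1985Averaging, (9) p.19; Balaban1985BackgroundPropagators, (3.1) p.390, (3.5) p.391] -/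
theorem coe_plaqHolU_unitsOfRecord (p : Plaq (F.P K) 0) :
    (plaqHolU (unitsOfRecord F N U₀) (siteToLit (F.P K) 0 p.src, ⟨(p.μ, p.ν), p.hμν⟩) : Matrix (Fin N) (Fin N) ℂ)
      = ((GaugeField.plaqHol U₀ p : SU N) : Matrix (Fin N) (Fin N) ℂ) := by
  have hb : ∀ (x : Site (F.P K) 0) (μ : Fin (F.P K).d),
      unitsOfRecord F N U₀ (siteToLit (F.P K) 0 x, μ) = suToUnits N (U₀ ⟨x, μ⟩) := fun x μ => by
    rw [unitsOfRecord, bondToLit_symm_apply, Equiv.symm_apply_apply]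
  simp only [plaqHolU, GaugeField.plaqHol, ← siteToLit_shift, hb, Units.val_mul, coe_suToUnits, coe_suToUnits_inv, Submonoid.coe_mul]

/-- The same for an ARBITRARY lit plaquette `p = (x, (μ, ν))`: it is the image of the tree plaquette `⟨siteToLit⁻¹ x, μ, ν⟩`. [cite: Balaban1985Averaging, (9) p.19; Balaban1985BackgroundPropagators, (3.1) p.390] -/
theorem coe_plaqHolU_unitsOfRecord' (p : B9SectCLatticeCarrier.Plaq (F.P K).d (fun _ => (F.P K).sitesPerDir 0)) :
    (plaqHolU (unitsOfRecord F N U₀) p : Matrix (Fin N) (Fin N) ℂ)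
      = ((GaugeField.plaqHol U₀ ⟨(siteToLit (F.P K) 0).symm p.1, p.2.1.1, p.2.1.2, p.2.2⟩ : SU N) : Matrix (Fin N) (Fin N) ℂ) := by
  rw [← coe_plaqHolU_unitsOfRecord F N U₀ ⟨(siteToLit (F.P K) 0).symm p.1, p.2.1.1, p.2.1.2, p.2.2⟩, Equiv.apply_symm_apply]

/-- ★ **`PlaqSmall δ U₀` ON THE TREE ⇒ THE `j = 0` PLAQUETTE CLAUSE ON LIT's CARRIER** with the same `δ`: `‖plaqHolU (unitsOfRecord U₀)(p) − 1‖ ≤ δ` for every lit plaquette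
(in the tree's `SU(N)` model `dist1 g = ‖↑g − 1‖` by definition). [cite: Balaban1987RG1, (0.18) p.255; Balaban1985Variational, (14) p.280; Balaban1985BackgroundPropagators, (3.1) p.390] -/
theorem norm_plaqHolU_unitsOfRecord_sub_one_le_of_plaqSmall {δ : ℝ} (hU : PlaqSmall δ U₀)
    (p : B9SectCLatticeCarrier.Plaq (F.P K).d (fun _ => (F.P K).sitesPerDir 0)) :
    ‖(plaqHolU (unitsOfRecord F N U₀) p : Matrix (Fin N) (Fin N) ℂ) - 1‖ ≤ δ := by
  rw [coe_plaqHolU_unitsOfRecord']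
  exact (hU _).le

/-- **FOR `0 < k` THE `j = 0` MEMBER OF THE (14) TOWER `hreg` IS `PlaqSmall (αη_k²) U₀`** (`Ū^0(U₀) = U₀` is `rfl`, `L^0 = 1`). [cite: Balaban1985Variational, (14) p.280; Balaban1987RG1, (0.18) p.255] -/
theorem plaqSmall_base_of_hreg {k : ℕ} (hk : 0 < k) {α : ℝ}
    (hreg : ∀ j, j < k → PlaqSmall (α * ((F.L : ℝ) ^ j * (F.P K).eta k) ^ 2) (Averaging.iter (avOfRecord F N K) j U₀)) :
    PlaqSmall (α * (F.P K).eta k ^ 2) U₀ := by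
  have h := hreg 0 hk
  rwa [pow_zero, one_mul] at h

end Bridge

/-! ## §2  F7's doors with the tree-side `j = 0` clause, and without it for `0 < k` -/

section Record

variable (F : T4Family) (N : ℕ) [NeZero N] (K k : ℕ) (Ω : ℕ → Set (Site (F.P K) 0)) (U₀ : GaugeField (F.P K) 0 (SU N))

/-- ★★ **F7 ✓`prop4UniformAtRecord_node00_of_HCol` WITH THE `j = 0` PLAQUETTE CLAUSE ON THE TREE's CARRIER** (`hpl0 : PlaqSmall (αη_k²) U₀` instead of lit's `hpl`).
[cite: Balaban1985Variational, Prop. 4 (97)–(98) pp.292–293, (14) p.280, (44)–(45) p.285, (86)–(89) p.291] -/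
theorem prop4UniformAtRecord_node00_of_HCol_plaqSmall [Fact (0 < (F.L : ℝ))] [Fact (0 < (F.P K).eta k)] [Fact (0 < c0Rec F K k)] [Fact (∀ c, 0 < wBRec F K k c)]
    (levB : PBond (F.P K) k → ℕ) (a : ℝ)
    (hpos : ∀ x, x ≠ 0 → 0 < RCLike.re ⟪x, laplaceAOfRecord F N k U₀ (QOfRecord F N k U₀) (QflatOfRecord F N k) a x⟫_ℂ)
    (hQ : Function.Surjective (QOfRecord F N k U₀))
    (Gp : SiteL2K ℂ (F.P K).d (fun _ => (F.P K).sitesPerDir 0) (c0Rec F K k) (WRec N) →ₗ[ℂ]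
      SiteL2K ℂ (F.P K).d (fun _ => (F.P K).sitesPerDir 0) (c0Rec F K k) (WRec N))
    {b α θ₃ θE θE' N₁ nJ : ℝ} (hb : 0 ≤ b) (hΩ : ∀ x, x ∈ Ω k) (hα0 : 0 ≤ α) (hα : α * (11000000 * N) ≤ 1)
    (hreg : ∀ j, j < k → PlaqSmall (α * ((F.L : ℝ) ^ j * (F.P K).eta k) ^ 2) (Averaging.iter (avOfRecord F N K) j U₀))
    (hpl0 : PlaqSmall (α * (F.P K).eta k ^ 2) U₀)
    (hH : Prop4LetterHAtRecord F N K k Ω U₀ levB a hpos hQ b)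
    (hcol : letI C₂ : ℝ := 12800000000000000 * (F.L : ℝ) * N
      letI c₄ : ℝ := 1 / (200000000000 * (F.L : ℝ) * N)
      letI r : ℝ := min (c₄ / 4) (min (1 / 2) (1 / (16 * (b * C₂ + 1))))
      Prop4LetterColumnsAtRecord F N K k Ω U₀ levB a hpos hQ r Gp (min r ((1 - 4 * b * C₂ * (r + r)) * (1 / 16))) θ₃ θE θE' N₁)
    (hJ : ‖JOfRecordAtBg F N K k Ω U₀‖ ≤ nJ) :
    letI C₂ : ℝ := 12800000000000000 * (F.L : ℝ) * N
    letI c₄ : ℝ := 1 / (200000000000 * (F.L : ℝ) * N)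
    letI r : ℝ := min (c₄ / 4) (min (1 / 2) (1 / (16 * (b * C₂ + 1))))
    letI R' : ℝ := min r ((1 - 4 * b * C₂ * (r + r)) * (1 / 16))
    letI CV : ℝ := 1024 * (((F.P K).d - 1 : ℕ) : ℝ) * ((1 : ℝ) * 1) ^ 3 * N * (α * (1 : ℝ) ^ 2 + 1 / 16)
        + (((F.P K).d - 1 : ℕ) : ℝ) * ((1 : ℝ) * 1) ^ 3 * (136 + 2 * ((1 : ℝ) * 1)) * N
    Prop4UniformAtRecord F N K k Ω U₀ levB a hpos hQ r Gp
      ((N * θ₃ * nJ + (N₁ * C₂ * (1 / (1 - 4 * b * C₂ * (r + r))) ^ 2 + N * θE')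
        + N * θE * (N₁ * C₂ * (1 / (1 - 4 * b * C₂ * (r + r))) ^ 2) * R'
        + N * (1 + θE * R') * CV * (1 / (1 - 4 * b * C₂ * (r + r))) ^ 2)) R' :=
  prop4UniformAtRecord_node00_of_HCol F N K k Ω U₀ levB a hpos hQ Gp hb hΩ hα0 hα hreg
    (norm_plaqHolU_unitsOfRecord_sub_one_le_of_plaqSmall F N U₀ hpl0) hH hcol hJ

/-- ★★ **F7 ✓`prop4UniformAtRecord_node00_of_HCol` FOR `0 < k` WITHOUT ANY SEPARATE `j = 0` CLAUSE**: the antecedent is (ℓa-H) + (ℓd) + print's (14) tower `hreg` + `‖J‖ ≤ nJ`.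
[cite: Balaban1985Variational, Prop. 4 (97)–(98) pp.292–293, (14) p.280, (44)–(45) p.285, (86)–(89) p.291] -/
theorem prop4UniformAtRecord_node00_of_HCol_pos [Fact (0 < (F.L : ℝ))] [Fact (0 < (F.P K).eta k)] [Fact (0 < c0Rec F K k)] [Fact (∀ c, 0 < wBRec F K k c)]
    (levB : PBond (F.P K) k → ℕ) (a : ℝ)
    (hpos : ∀ x, x ≠ 0 → 0 < RCLike.re ⟪x, laplaceAOfRecord F N k U₀ (QOfRecord F N k U₀) (QflatOfRecord F N k) a x⟫_ℂ)
    (hQ : Function.Surjective (QOfRecord F N k U₀))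
    (Gp : SiteL2K ℂ (F.P K).d (fun _ => (F.P K).sitesPerDir 0) (c0Rec F K k) (WRec N) →ₗ[ℂ]
      SiteL2K ℂ (F.P K).d (fun _ => (F.P K).sitesPerDir 0) (c0Rec F K k) (WRec N))
    {b α θ₃ θE θE' N₁ nJ : ℝ} (hk : 0 < k) (hb : 0 ≤ b) (hΩ : ∀ x, x ∈ Ω k) (hα0 : 0 ≤ α) (hα : α * (11000000 * N) ≤ 1)
    (hreg : ∀ j, j < k → PlaqSmall (α * ((F.L : ℝ) ^ j * (F.P K).eta k) ^ 2) (Averaging.iter (avOfRecord F N K) j U₀))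
    (hH : Prop4LetterHAtRecord F N K k Ω U₀ levB a hpos hQ b)
    (hcol : letI C₂ : ℝ := 12800000000000000 * (F.L : ℝ) * N
      letI c₄ : ℝ := 1 / (200000000000 * (F.L : ℝ) * N)
      letI r : ℝ := min (c₄ / 4) (min (1 / 2) (1 / (16 * (b * C₂ + 1))))
      Prop4LetterColumnsAtRecord F N K k Ω U₀ levB a hpos hQ r Gp (min r ((1 - 4 * b * C₂ * (r + r)) * (1 / 16))) θ₃ θE θE' N₁)
    (hJ : ‖JOfRecordAtBg F N K k Ω U₀‖ ≤ nJ) :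
    letI C₂ : ℝ := 12800000000000000 * (F.L : ℝ) * N
    letI c₄ : ℝ := 1 / (200000000000 * (F.L : ℝ) * N)
    letI r : ℝ := min (c₄ / 4) (min (1 / 2) (1 / (16 * (b * C₂ + 1))))
    letI R' : ℝ := min r ((1 - 4 * b * C₂ * (r + r)) * (1 / 16))
    letI CV : ℝ := 1024 * (((F.P K).d - 1 : ℕ) : ℝ) * ((1 : ℝ) * 1) ^ 3 * N * (α * (1 : ℝ) ^ 2 + 1 / 16)
        + (((F.P K).d - 1 : ℕ) : ℝ) * ((1 : ℝ) * 1) ^ 3 * (136 + 2 * ((1 : ℝ) * 1)) * N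
    Prop4UniformAtRecord F N K k Ω U₀ levB a hpos hQ r Gp
      ((N * θ₃ * nJ + (N₁ * C₂ * (1 / (1 - 4 * b * C₂ * (r + r))) ^ 2 + N * θE')
        + N * θE * (N₁ * C₂ * (1 / (1 - 4 * b * C₂ * (r + r))) ^ 2) * R'
        + N * (1 + θE * R') * CV * (1 / (1 - 4 * b * C₂ * (r + r))) ^ 2)) R' :=
  prop4UniformAtRecord_node00_of_HCol_plaqSmall F N K k Ω U₀ levB a hpos hQ Gp hb hΩ hα0 hα hreg (plaqSmall_base_of_hreg F N U₀ hk hreg) hH hcol hJ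

/-- ★★ **F7 ✓`prop4UniformAtRecord_node00_of_HCol_window` WITH THE TREE-SIDE `j = 0` CLAUSE** (`‖J‖ ≤ C₁B₃ε₁` from the (14) current window by ✓`Node00.norm_JOfRecordAtBg_le`).
[cite: Balaban1985Variational, Prop. 4 (97)–(98) pp.292–293, (14) p.280, (28) p.282] -/
theorem prop4UniformAtRecord_node00_of_HCol_window_plaqSmall [Fact (0 < (F.L : ℝ))] [Fact (0 < (F.P K).eta k)] [Fact (0 < c0Rec F K k)]
    [Fact (∀ c, 0 < wBRec F K k c)] (levB : PBond (F.P K) k → ℕ) (a : ℝ)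
    (hpos : ∀ x, x ≠ 0 → 0 < RCLike.re ⟪x, laplaceAOfRecord F N k U₀ (QOfRecord F N k U₀) (QflatOfRecord F N k) a x⟫_ℂ)
    (hQ : Function.Surjective (QOfRecord F N k U₀))
    (Gp : SiteL2K ℂ (F.P K).d (fun _ => (F.P K).sitesPerDir 0) (c0Rec F K k) (WRec N) →ₗ[ℂ]
      SiteL2K ℂ (F.P K).d (fun _ => (F.P K).sitesPerDir 0) (c0Rec F K k) (WRec N))
    {b α θ₃ θE θE' N₁ C₁ B₃ ε₁ : ℝ} (hb : 0 ≤ b) (hΩ : ∀ x, x ∈ Ω k) (hα0 : 0 ≤ α) (hα : α * (11000000 * N) ≤ 1)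
    (hreg : ∀ j, j < k → PlaqSmall (α * ((F.L : ℝ) ^ j * (F.P K).eta k) ^ 2) (Averaging.iter (avOfRecord F N K) j U₀))
    (hpl0 : PlaqSmall (α * (F.P K).eta k ^ 2) U₀)
    (hK : 0 ≤ C₁ * B₃ * ε₁) (h14 : B11Prop6Concrete.InU2cur (F.L : ℝ) ((F.P K).eta k) (bondLevLit F Ω k) (C₁ * B₃ * ε₁) (unitsOfRecord F N U₀))
    (hH : Prop4LetterHAtRecord F N K k Ω U₀ levB a hpos hQ b)
    (hcol : letI C₂ : ℝ := 12800000000000000 * (F.L : ℝ) * N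
      letI c₄ : ℝ := 1 / (200000000000 * (F.L : ℝ) * N)
      letI r : ℝ := min (c₄ / 4) (min (1 / 2) (1 / (16 * (b * C₂ + 1))))
      Prop4LetterColumnsAtRecord F N K k Ω U₀ levB a hpos hQ r Gp (min r ((1 - 4 * b * C₂ * (r + r)) * (1 / 16))) θ₃ θE θE' N₁) :
    letI C₂ : ℝ := 12800000000000000 * (F.L : ℝ) * N
    letI c₄ : ℝ := 1 / (200000000000 * (F.L : ℝ) * N)
    letI r : ℝ := min (c₄ / 4) (min (1 / 2) (1 / (16 * (b * C₂ + 1))))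
    letI R' : ℝ := min r ((1 - 4 * b * C₂ * (r + r)) * (1 / 16))
    letI CV : ℝ := 1024 * (((F.P K).d - 1 : ℕ) : ℝ) * ((1 : ℝ) * 1) ^ 3 * N * (α * (1 : ℝ) ^ 2 + 1 / 16)
        + (((F.P K).d - 1 : ℕ) : ℝ) * ((1 : ℝ) * 1) ^ 3 * (136 + 2 * ((1 : ℝ) * 1)) * N
    Prop4UniformAtRecord F N K k Ω U₀ levB a hpos hQ r Gp
      ((N * θ₃ * (C₁ * B₃ * ε₁) + (N₁ * C₂ * (1 / (1 - 4 * b * C₂ * (r + r))) ^ 2 + N * θE')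
        + N * θE * (N₁ * C₂ * (1 / (1 - 4 * b * C₂ * (r + r))) ^ 2) * R'
        + N * (1 + θE * R') * CV * (1 / (1 - 4 * b * C₂ * (r + r))) ^ 2)) R' :=
  prop4UniformAtRecord_node00_of_HCol_window F N K k Ω U₀ levB a hpos hQ Gp hb hΩ hα0 hα hreg
    (norm_plaqHolU_unitsOfRecord_sub_one_le_of_plaqSmall F N U₀ hpl0) hK h14 hH hcol

/-- ★★ **F7 ✓`prop4UniformAtRecord_node00_of_HCol_window` FOR `0 < k` WITHOUT ANY SEPARATE `j = 0` CLAUSE**: antecedent = (ℓa-H) + (ℓd) + print's (14) (`hreg` + the current window).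
[cite: Balaban1985Variational, Prop. 4 (97)–(98) pp.292–293, (14) p.280, (28) p.282] -/
theorem prop4UniformAtRecord_node00_of_HCol_window_pos [Fact (0 < (F.L : ℝ))] [Fact (0 < (F.P K).eta k)] [Fact (0 < c0Rec F K k)]
    [Fact (∀ c, 0 < wBRec F K k c)] (levB : PBond (F.P K) k → ℕ) (a : ℝ)
    (hpos : ∀ x, x ≠ 0 → 0 < RCLike.re ⟪x, laplaceAOfRecord F N k U₀ (QOfRecord F N k U₀) (QflatOfRecord F N k) a x⟫_ℂ)
    (hQ : Function.Surjective (QOfRecord F N k U₀))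
    (Gp : SiteL2K ℂ (F.P K).d (fun _ => (F.P K).sitesPerDir 0) (c0Rec F K k) (WRec N) →ₗ[ℂ]
      SiteL2K ℂ (F.P K).d (fun _ => (F.P K).sitesPerDir 0) (c0Rec F K k) (WRec N))
    {b α θ₃ θE θE' N₁ C₁ B₃ ε₁ : ℝ} (hk : 0 < k) (hb : 0 ≤ b) (hΩ : ∀ x, x ∈ Ω k) (hα0 : 0 ≤ α) (hα : α * (11000000 * N) ≤ 1)
    (hreg : ∀ j, j < k → PlaqSmall (α * ((F.L : ℝ) ^ j * (F.P K).eta k) ^ 2) (Averaging.iter (avOfRecord F N K) j U₀))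
    (hK : 0 ≤ C₁ * B₃ * ε₁) (h14 : B11Prop6Concrete.InU2cur (F.L : ℝ) ((F.P K).eta k) (bondLevLit F Ω k) (C₁ * B₃ * ε₁) (unitsOfRecord F N U₀))
    (hH : Prop4LetterHAtRecord F N K k Ω U₀ levB a hpos hQ b)
    (hcol : letI C₂ : ℝ := 12800000000000000 * (F.L : ℝ) * N
      letI c₄ : ℝ := 1 / (200000000000 * (F.L : ℝ) * N)
      letI r : ℝ := min (c₄ / 4) (min (1 / 2) (1 / (16 * (b * C₂ + 1))))
      Prop4LetterColumnsAtRecord F N K k Ω U₀ levB a hpos hQ r Gp (min r ((1 - 4 * b * C₂ * (r + r)) * (1 / 16))) θ₃ θE θE' N₁) :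
    letI C₂ : ℝ := 12800000000000000 * (F.L : ℝ) * N
    letI c₄ : ℝ := 1 / (200000000000 * (F.L : ℝ) * N)
    letI r : ℝ := min (c₄ / 4) (min (1 / 2) (1 / (16 * (b * C₂ + 1))))
    letI R' : ℝ := min r ((1 - 4 * b * C₂ * (r + r)) * (1 / 16))
    letI CV : ℝ := 1024 * (((F.P K).d - 1 : ℕ) : ℝ) * ((1 : ℝ) * 1) ^ 3 * N * (α * (1 : ℝ) ^ 2 + 1 / 16)
        + (((F.P K).d - 1 : ℕ) : ℝ) * ((1 : ℝ) * 1) ^ 3 * (136 + 2 * ((1 : ℝ) * 1)) * N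
    Prop4UniformAtRecord F N K k Ω U₀ levB a hpos hQ r Gp
      ((N * θ₃ * (C₁ * B₃ * ε₁) + (N₁ * C₂ * (1 / (1 - 4 * b * C₂ * (r + r))) ^ 2 + N * θE')
        + N * θE * (N₁ * C₂ * (1 / (1 - 4 * b * C₂ * (r + r))) ^ 2) * R'
        + N * (1 + θE * R') * CV * (1 / (1 - 4 * b * C₂ * (r + r))) ^ 2)) R' :=
  prop4UniformAtRecord_node00_of_HCol_window_plaqSmall F N K k Ω U₀ levB a hpos hQ Gp hb hΩ hα0 hα hreg (plaqSmall_base_of_hreg F N U₀ hk hreg)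
    hK h14 hH hcol

end Record

end Summit.QuantumFields.YangMills.Theorems.C44IterMh

end
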